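import Summits.AtomisticToContinuum.FouriersLaw.Theses.MatthiessenLadder
import Literature.MathematicalPhysics.KineticTheory.LangevinChainDegenerateHormander
import Literature.MathematicalPhysics.KineticTheory.LangevinChainConfinedLaSalle
import Literature.MathematicalPhysics.KineticTheory.LangevinChainConfinedKalman
import Literature.MathematicalPhysics.KineticTheory.ConfinedLocalMinorization
import Literature.Analysis.Hypoelliptic.HormanderProof
import HarnessLib

/-!
# Weak-NESS uniqueness for the pinned HARMONIC chain (the `k = 0` rung of the prefix ladder)

Helper for crux `PrefixSteadyStates` (route `MatthiessenLadder`, item stmt-AtomisticToContinuum-12778,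
registered stub `stub_harmonicNessUnique` of the reshaped skeleton r2; also the harmonic-base
uniqueness hypothesis consumed by `MatthiessenLadderLimitGlue`). The rung `k = 0` of the prefix ladder,
`cellChain ω₂ lam β γ (· < 0)`, IS the pinned harmonic chain `pinnedChain ω₂ 0 0 γ`
(`cellChain_const_false` + locality). Its weak steady states (`OscillatorChain.IsSteadyState`:
probability, `∫ L f dμ = 0` on `C_c^∞`, integrable bond currents) are UNIQUE — the statement
`HarmonicNessUnique` which `Cruxes/NonBallistic/Disproof.lean` records as "true in print but not in
the tree". It is assembled here ENTIRELY from in-tree theorems typed over a general confining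
`OscillatorChain` (no new mathematics, Hörmander-free on the dynamical side):

* invariant-measure uniqueness for the constructed semigroup `IsConfining.semigroup` of
  `pinnedChain ω₂ 0 0 γ`: Kalman's condition at the equilibrium (`V'' = 1 ≠ 0`,
  `eq_zero_of_forall_pow_unitP_zero₂`) ⇒ a local small set (`ConfinedDrift.exists_localSmall_window`)
  ⇒ `IsConfining.invariant_unique_of_localSmall` (LaSalle: `V' = id` injective, `Φ q = 0 ⇒ q = 0`);
* Fokker–Planck identification `weak steady state ⇒ invariant`: smooth density from Hörmander's
  theorem (`hasSmoothDensity_of_integral_generator_eq_zero`, `RBNondegenerate (r²/2)`, Hörmander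
  1967 Thm 1.1 proved in tree), pointwise adjoint equation (`revGenerator_add_eq_zero_of_weak`),
  polynomial volume growth (`pinnedChain_volume_sublevel_le` at `lam = β = 0`), and
  `withDensity_bind_langevinKernel_of_revGenerator`.
-/

noncomputable section

open MeasureTheory ProbabilityTheory Filter Topology Set
open scoped NNReal ENNReal ContDiff

namespace Summit.AtomisticToContinuum.FouriersLaw.Theorems.PrefixSteadyStates.LineRegistered

open Literature.MathematicalPhysics.KineticTheory.HeatConduction
open Literature.MathematicalPhysics.KineticTheory Literature.Probability.Process OscillatorChain
open Summit.AtomisticToContinuum.FouriersLaw.Theorems.SubdiffusiveBondHeat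
open Summit.AtomisticToContinuum.FouriersLaw.Theorems.NessUnique

variable {N : ℕ}

/-! ### Elementary facts about the harmonic chain `pinnedChain ω₂ 0 0 γ` -/

/-- The pinned harmonic chain has confining potentials (`ω₂ > 0`, `γ ≥ 0`). [folklore] -/
theorem harmonicChain_isConfining {ω₂ γ : ℝ} (hω : 0 < ω₂) (hγ : 0 ≤ γ) :
    (pinnedChain ω₂ 0 0 γ).IsConfining :=
  pinnedChain_isConfining hω le_rfl le_rfl hγ

/-- `V'' ≡ 1` for the harmonic coupling `r²/2 + 0·r⁴/4`. [folklore] -/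
theorem harmonicChain_deriv_deriv_V (ω₂ γ r : ℝ) :
    deriv (deriv (pinnedChain ω₂ 0 0 γ).V) r = 1 := by
  rw [pinnedChain_deriv_deriv_V]; ring

/-- The harmonic coupling is non-degenerate in the pointwise sense of Rey-Bellet–Thomas
(`m = 2` everywhere). [folklore] -/
theorem harmonicChain_rbNondegenerate_V (ω₂ γ : ℝ) : RBNondegenerate (pinnedChain ω₂ 0 0 γ).V := by
  intro r
  refine ⟨2, le_rfl, ?_⟩
  rw [iteratedDeriv_succ, iteratedDeriv_one, harmonicChain_deriv_deriv_V]
  exact one_ne_zero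

/-- The origin is an equilibrium of the Langevin drift of the harmonic chain. [folklore] -/
theorem harmonicChain_drift_zero {ω₂ γ : ℝ} (hω : 0 < ω₂) (hγ : 0 ≤ γ) (N : ℕ) :
    (pinnedChain ω₂ 0 0 γ).drift N 0 = 0 := by
  rw [(harmonicChain_isConfining hω hγ).drift_apply N 0]
  refine Prod.ext rfl (funext fun i => ?_)
  simp [OscillatorChain.dPotential, pinnedChain_deriv_U, pinnedChain_deriv_V]

/-- **Kalman's condition at the equilibrium for the left bath direction** of the harmonic chain
(`γ, T_L > 0`, `N ≥ 1`). [folklore] -/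
theorem harmonicChain_kalman_bathVecL {ω₂ γ : ℝ} (hγ : 0 < γ) (hN : 0 < N) {T_L : ℝ}
    (hTL : 0 < T_L) (ℓ : PhaseSpace N →ₗ[ℝ] ℝ)
    (h : ∀ j : ℕ, ℓ (((fderiv ℝ ((pinnedChain ω₂ 0 0 γ).drift N) 0) ^ j)
      ((pinnedChain ω₂ 0 0 γ).bathVecL N T_L)) = 0) :
    ℓ = 0 := by
  set P := pinnedChain ω₂ 0 0 γ with hP
  have hcL : Real.sqrt (2 * γ * T_L) ≠ 0 := (Real.sqrt_pos.2 (by positivity)).ne'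
  have hbL : P.bathVecL N T_L = Real.sqrt (2 * γ * T_L) • unitP ⟨0, hN⟩ := by
    show bathVec N 0 (Real.sqrt (2 * γ * T_L)) = _
    rw [bathVec_eq_smul_unitP hN]
  have hV0 : deriv (deriv P.V) 0 ≠ 0 := by
    rw [hP, harmonicChain_deriv_deriv_V ω₂ γ 0]
    exact one_ne_zero
  refine P.eq_zero_of_forall_pow_unitP_zero₂ (pinnedChain_contDiff_U ω₂ 0 0 γ)
    (pinnedChain_contDiff_V ω₂ 0 0 γ) hV0 hN ℓ fun j => ?_
  have hj := h j
  rw [hbL, ContinuousLinearMap.map_smul, LinearMap.map_smul, smul_eq_mul] at hj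
  exact (mul_eq_zero.1 hj).resolve_left hcL

/-- **A local small set of the harmonic chain at the equilibrium, in a time window**
(Hörmander-free: `ConfinedDrift.exists_localSmall_window`). [folklore] -/
theorem harmonicChain_localSmall {ω₂ γ : ℝ} (hω : 0 < ω₂) (hγ : 0 < γ) (hN : 0 < N) {T_L : ℝ}
    (hTL : 0 < T_L) (T_R : ℝ) :
    ∃ (G₀ U₀ : Set (PhaseSpace N)) (η : ℝ≥0∞) (t₀ δ : ℝ), IsOpen G₀ ∧ (0 : PhaseSpace N) ∈ G₀ ∧
      IsOpen U₀ ∧ U₀.Nonempty ∧ 0 < η ∧ 0 < δ ∧ δ ≤ t₀ ∧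
      ∀ t : ℝ≥0, t₀ - δ ≤ (t : ℝ) → (t : ℝ) ≤ t₀ + δ → ∀ w ∈ G₀,
        η • (volume : Measure (PhaseSpace N)).restrict U₀ ≤
          (pinnedChain ω₂ 0 0 γ).langevinKernel N T_L T_R t w := by
  set P := pinnedChain ω₂ 0 0 γ with hP
  have hPc : P.IsConfining := harmonicChain_isConfining hω hγ.le
  let D : ConfinedDrift (P.drift N) := (hPc.confinedDrift N).toConfinedDrift
  have hY : ContDiff ℝ 1 (P.drift N) :=
    P.contDiff_one_drift (pinnedChain_contDiff_U ω₂ 0 0 γ) (pinnedChain_contDiff_V ω₂ 0 0 γ) N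
  have hx₀ : P.drift N 0 = 0 := harmonicChain_drift_zero hω hγ.le N
  have hv₁ : P.bathVecL N T_L ∈ D.noise := hPc.bathVec_mem_noise N 0 _
  have hv₂ : P.bathVecR N T_R ∈ D.noise := hPc.bathVec_mem_noise N (N - 1) _
  have hKal : ∀ ℓ : PhaseSpace N →ₗ[ℝ] ℝ,
      (∀ j : ℕ, ℓ (((fderiv ℝ (P.drift N) 0) ^ j) (P.bathVecL N T_L)) = 0) → ℓ = 0 :=
    fun ℓ h => harmonicChain_kalman_bathVecL hγ hN hTL ℓ h
  haveI hpi : (volume : Measure (Fin N → ℝ)).IsAddHaarMeasure := isAddHaarMeasure_volume_pi _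
  haveI : (volume : Measure (PhaseSpace N)).IsAddHaarMeasure :=
    Measure.prod.instIsAddHaarMeasure (volume : Measure (Fin N → ℝ)) (volume : Measure (Fin N → ℝ))
  obtain ⟨G₀, U₀, η, t₀, δ, hG₀, h0, hU₀, hU₀ne, hη, hδ, hδt, hmin⟩ :=
    D.exists_localSmall_window hY hx₀ hv₁ hv₂ hKal (volume : Measure (PhaseSpace N))
  exact ⟨G₀, U₀, η, t₀, δ, hG₀, h0, hU₀, hU₀ne, hη, hδ, hδt, hmin⟩

/-- **At most one invariant probability measure for the transition semigroup of the harmonic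
chain** (`ω₂, γ > 0`, `N ≥ 1`, `T_L > 0`, `T_R ≥ 0`): local small set + LaSalle irreducibility
(`V' = id` injective, `Φ` positive definite) + small-set cover. [folklore] -/
theorem harmonicChain_invariant_unique {ω₂ γ : ℝ} (hω : 0 < ω₂) (hγ : 0 < γ) (hN : 0 < N)
    {T_L T_R : ℝ} (hTL : 0 < T_L) (hTR : 0 ≤ T_R) {μ ν : Measure (PhaseSpace N)}
    [IsProbabilityMeasure μ] [IsProbabilityMeasure ν]
    (hμ : ((harmonicChain_isConfining hω hγ.le).semigroup N T_L T_R hN hTL.le hTR).IsInvariant μ)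
    (hν : ((harmonicChain_isConfining hω hγ.le).semigroup N T_L T_R hN hTL.le hTR).IsInvariant ν) :
    μ = ν := by
  obtain ⟨G₀, U₀, η, t₀, δ, hG₀, h0, hU₀, ⟨y₀, hy₀⟩, hη, hδ, hδt, hmin⟩ :=
    harmonicChain_localSmall hω hγ hN hTL T_R
  have hVinj : Function.Injective (deriv (pinnedChain ω₂ 0 0 γ).V) :=
    pinnedChain_deriv_V_injective ω₂ 0 le_rfl γ
  have hcrit : ∀ q : Fin N → ℝ, (∀ i, (pinnedChain ω₂ 0 0 γ).dPotential N i q = 0) → q = 0 :=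
    fun q hq => pinnedChain_eq_zero_of_dPotential_eq_zero hω le_rfl le_rfl γ N q hq
  refine (harmonicChain_isConfining hω hγ.le).invariant_unique_of_localSmall N (by exact hγ) hN hVinj
    hcrit hTL.le hTR hG₀ h0 (ν₀ := η • (volume : Measure (PhaseSpace N)).restrict U₀) (y₀ := y₀)
    (fun V hV hyV => ?_) hδ hδt hmin hμ hν
  rw [Measure.smul_apply, Measure.restrict_apply hV.measurableSet, smul_eq_mul]
  exact ENNReal.mul_pos hη.ne' ((hV.inter hU₀).measure_pos volume ⟨y₀, hyV, hy₀⟩).ne'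

/-- **Weak steady states of the harmonic chain are invariant for its transition semigroup**
(`N ≥ 1`, `T_L, T_R > 0`): smooth density by Hörmander (bracket condition from `V'' = 1`),
`L̂ρ + 2γρ = 0` pointwise, and `(ρ dx) P_t = ρ dx`. [folklore] -/
theorem harmonicChain_isInvariant_of_isSteadyState {ω₂ γ : ℝ} (hω : 0 < ω₂) (hγ : 0 < γ)
    (hN : 0 < N) {T_L T_R : ℝ} (hL : 0 < T_L) (hR : 0 < T_R) {μ : Measure (PhaseSpace N)}
    (hμ : (pinnedChain ω₂ 0 0 γ).IsSteadyState N T_L T_R μ) :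
    ((harmonicChain_isConfining hω hγ.le).semigroup N T_L T_R hN hL.le hR.le).IsInvariant μ := by
  set P := pinnedChain ω₂ 0 0 γ with hPdef
  obtain ⟨hprob, hweak, -⟩ := hμ
  have hPc : P.IsConfining := harmonicChain_isConfining hω hγ.le
  have hU : ContDiff ℝ ((⊤ : ℕ∞) : WithTop ℕ∞) P.U := pinnedChain_contDiff_U ω₂ 0 0 γ
  have hV : ContDiff ℝ ((⊤ : ℕ∞) : WithTop ℕ∞) P.V := pinnedChain_contDiff_V ω₂ 0 0 γ
  have hγP : 0 < P.γ := hγ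
  -- smooth density (Hörmander, bracket condition from the RB-non-degenerate coupling)
  obtain ⟨ρ, hρs, hρ0, hμρ⟩ : HasSmoothDensity μ :=
    P.hasSmoothDensity_of_integral_generator_eq_zero
      Literature.Analysis.Hypoelliptic.hormander1967_thm11_proof hU hV
      (harmonicChain_rbNondegenerate_V ω₂ γ) hγP hN hL hR.le μ hweak
  have hρ2 : ContDiff ℝ 2 ρ := hρs.of_le (by norm_cast)
  have hρc : Continuous ρ := hρs.continuous
  -- the density is integrable (μ is a probability measure)
  have hlin : ∫⁻ x, ENNReal.ofReal (ρ x) = μ Set.univ := by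
    rw [hμρ, withDensity_apply _ MeasurableSet.univ, Measure.restrict_univ]
  have hρi : Integrable ρ := by
    refine ⟨hρc.aestronglyMeasurable, ?_⟩
    rw [hasFiniteIntegral_iff_enorm]
    have e : ∀ x, ‖ρ x‖ₑ = ENNReal.ofReal (ρ x) := fun x => Real.enorm_eq_ofReal (hρ0 x)
    simp_rw [e, hlin]
    exact measure_lt_top μ _
  -- the weak equation against the density, and the pointwise Fokker–Planck equation
  have hweak' : ∀ φ : PhaseSpace N → ℝ, ContDiff ℝ ∞ φ → HasCompactSupport φ →
      ∫ x, P.generator N T_L T_R φ x * ρ x = 0 := by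
    intro φ hφ hφc
    have h := hweak φ hφ hφc
    have e : (fun x => ENNReal.ofReal (ρ x)) = fun x => ((ρ x).toNNReal : ℝ≥0∞) := rfl
    rw [hμρ, e, integral_withDensity_eq_integral_smul hρc.measurable.real_toNNReal] at h
    rw [← h]
    refine integral_congr_ae (Eventually.of_forall fun x => ?_)
    show P.generator N T_L T_R φ x * ρ x = (ρ x).toNNReal • P.generator N T_L T_R φ x
    rw [NNReal.smul_def, smul_eq_mul, Real.coe_toNNReal _ (hρ0 x), mul_comm]
  have hpde := revGenerator_add_eq_zero_of_weak P hU hV hN (mul_nonneg hγ.le hL.le)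
    (mul_nonneg hγ.le hR.le) hρ2 hweak'
  -- polynomial volume growth of the sublevel sets
  have hvol : ∃ (C : ℝ) (d : ℕ), 0 ≤ C ∧ ∀ R : ℝ, 1 ≤ R →
      (volume {x : PhaseSpace N | P.hamiltonian N x ≤ 4 * R}).toReal ≤ C * R ^ d := by
    obtain ⟨C, d, hC, hCE⟩ := pinnedChain_volume_sublevel_le hω le_rfl le_rfl γ N
    refine ⟨C * 4 ^ d, d, by positivity, fun R hR1 => ?_⟩
    have h := hCE (4 * R) (by linarith)
    calc (volume {x : PhaseSpace N | P.hamiltonian N x ≤ 4 * R}).toReal ≤ C * (4 * R) ^ d := h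
      _ = C * 4 ^ d * R ^ d := by rw [mul_pow]; ring
  -- invariance of `ρ dx` for the model-free kernels = the kernels of the semigroup
  intro t
  have hinv := withDensity_bind_langevinKernel_of_revGenerator hU hV hN hL.le hR.le hρ2 hρ0 hρi
    hpde hvol hPc t
  show μ.bind ((hPc.semigroup N T_L T_R hN hL.le hR.le).kernel t) = μ
  rw [OscillatorChain.IsConfining.semigroup_kernel, hμρ]
  exact hinv

/-- **`HarmonicNessUnique` — weak-NESS uniqueness for the pinned harmonic chain** (`ω₂, γ > 0`,
every `N`, all `T_L, T_R > 0`): any two weak steady states of `pinnedChain ω₂ 0 0 γ` coincide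
(both are invariant for the transition semigroup, which has at most one invariant probability
measure; `N = 0`: phase space is a point). [cite: CuneoEckmannHairerReyBellet2018, Thm 2.13] -/
theorem harmonicChain_nessUnique {ω₂ γ : ℝ} (hω : 0 < ω₂) (hγ : 0 < γ) (N : ℕ) {T_L T_R : ℝ}
    (hL : 0 < T_L) (hR : 0 < T_R) (μ ν : Measure (PhaseSpace N))
    (hμ : (pinnedChain ω₂ 0 0 γ).IsSteadyState N T_L T_R μ)
    (hν : (pinnedChain ω₂ 0 0 γ).IsSteadyState N T_L T_R ν) : μ = ν := by
  rcases Nat.eq_zero_or_pos N with rfl | hN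
  · haveI := hμ.1
    haveI := hν.1
    refine Measure.ext fun A _ => ?_
    rcases A.eq_empty_or_nonempty with rfl | hne
    · simp
    · rw [Subsingleton.eq_univ_of_nonempty hne, measure_univ, measure_univ]
  · haveI := hμ.1
    haveI := hν.1
    exact harmonicChain_invariant_unique hω hγ hN hL hR.le
      (harmonicChain_isInvariant_of_isSteadyState hω hγ hN hL hR hμ)
      (harmonicChain_isInvariant_of_isSteadyState hω hγ hN hL hR hν)


/-- **Registered stub `stub_harmonicNessUnique` of crux `PrefixSteadyStates` (line `registered`,
reshape r2): weak-NESS uniqueness of the pinned harmonic chain**, by `harmonicChain_nessUnique`.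
[cite: CuneoEckmannHairerReyBellet2018, Thm 2.13] -/
theorem stub_harmonicNessUnique :
    ∀ ω₂ γ : ℝ, 0 < ω₂ → 0 < γ → ∀ (N : ℕ) (T_L T_R : ℝ), 0 < T_L → 0 < T_R →
      ∀ μ ν : Measure (PhaseSpace N),
        (pinnedChain ω₂ 0 0 γ).IsSteadyState N T_L T_R μ →
        (pinnedChain ω₂ 0 0 γ).IsSteadyState N T_L T_R ν → μ = ν :=
  fun _ _ hω hγ N _ _ hL hR μ ν hμ hν => harmonicChain_nessUnique hω hγ N hL hR μ ν hμ hν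

end Summit.AtomisticToContinuum.FouriersLaw.Theorems.PrefixSteadyStates.LineRegistered

end
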